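import Mathlib
import HarnessLib
import Literature.Analysis.FluidPDE.Tao2016AveragedNS.TaylorChainCertificate
import Summits.NavierStokesRegularity.NavierStokesRegularity.Theorems.TaylorModelRungThreeDefs
import Summits.NavierStokesRegularity.NavierStokesRegularity.Theorems.TaylorModelRungThreeReadoutJets
import Summits.NavierStokesRegularity.NavierStokesRegularity.Theorems.TaylorModelRungThreeReadoutCoords
import Summits.NavierStokesRegularity.NavierStokesRegularity.Theorems.TaylorModelRungThreeReadoutPackage

/-!
# Line `taylor-model` on crux K1b-DR (stmt-NavierStokesRegularity-23954) — stub G0i, part 1: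
# S1 instantiated in window coordinates, the lifted cascade flow, and (F0)–(F3) of the flow package

Toward the stub `FlowPackageExists : ∀ cd, cd.Valid → TaylorModelSoundness → ∃ φ, IsFlowPackage cd φ` of the
reshaped skeleton (v4, line owner ns-idea-2 g3). This file

* names S1's conclusion for stage `j` in window coordinates — `WindowPack cd j Φw` (the body of
  `TaylorModelSoundness` with `n := nW cd`, `Q := Qw cd`, `w := wW cd j`, `b := cd.bb j`, `T := taylorJet (Qw cd)`,
  `U := varJet (Qw cd)`, texts verbatim) — and INSTANTIATES S1: `exists_windowPack` (hypotheses: positive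
  weights `cd.ω j`, `0 ≤ cd.bb j`, the certificate's weighted bilinear bound (B); linearity of `Qw` and the
  jet recursions are the tree lemmas of helpers 0a/0b);
* lifts a window flow to K1b-DR's shape `liftFlow cd Φw : (Fin 4 → ℤ → ℝ) → Fin 4 → ℤ → ℝ → ℝ` (zero off the
  window) and proves the first four clauses of `IsFlowPackage` for it: (F0) `liftFlow_off_window`, (F1)
  `solvesOn_liftFlow` + `inBall_stAt_liftFlow`, (F2) `liftFlow_unique`, (F3) `inBall_stAt_liftFlow_sub`.

MODEL-lattice bookkeeping only (rung TL-M3); nothing here is a statement about the Navier–Stokes equations.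
-/

noncomputable section

-- the sub-problem namespace repeats the summit name by design (D-0017)
set_option linter.dupNamespace false

namespace Summit.NavierStokesRegularity.NavierStokesRegularity.Theorems.TaylorModelReadout

open scoped BigOperators
open Set Finset Literature.Analysis.FluidPDE.TaoCascade Literature.Analysis.FluidPDE.TaoCascade.TaylorChain
open Summit.NavierStokesRegularity.NavierStokesRegularity.Theorems.TaylorModel

variable (cd : CertData)

/-! ### S1 in window coordinates -/

/-- **S1's conclusion for stage `j`, in window coordinates** (the body of `TaylorModelSoundness` at
`n := nW cd`, `Q := Qw cd`, `w := wW cd j`, `b := cd.bb j`, `T := taylorJet (Qw cd)`, `U := varJet (Qw cd)`).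
[folklore] -/
def WindowPack (j : ℕ) (Φ : (Fin (nW cd) → ℝ) → ℝ → Fin (nW cd) → ℝ) : Prop :=
      (∀ x, Φ x 0 = x) ∧
      (∀ (x : Fin (nW cd) → ℝ) (t : ℝ) (ψ : ℝ → Fin (nW cd) → ℝ), 0 ≤ t → ψ 0 = x →
        (∀ s ∈ Icc 0 t, HasDerivWithinAt ψ (Qw cd (ψ s) (ψ s)) (Icc 0 t) s) → ∀ s ∈ Icc 0 t, ψ s = Φ x s) ∧
      ∀ (x : Fin (nW cd) → ℝ) (m t : ℝ), 0 ≤ m → (∀ c, |x c| ≤ m * wW cd j c) → 0 ≤ t → cd.bb j * m * t < 1 →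
        (∀ s ∈ Icc 0 t, HasDerivWithinAt (Φ x) (Qw cd (Φ x s) (Φ x s)) (Icc 0 t) s) ∧
        (∀ (k : ℕ) c, |taylorJet (Qw cd) x k c| ≤ m * (cd.bb j * m) ^ k * wW cd j c) ∧
        (∀ s ∈ Icc 0 t, ∀ c, |Φ x s c| ≤ m / (1 - cd.bb j * m * s) * wW cd j c) ∧
        (∀ s ∈ Icc 0 t, ∀ (p : ℕ) c,
          |Φ x s c - ∑ k ∈ Finset.range (p + 1), taylorJet (Qw cd) x k c * s ^ k| ≤
            m * (cd.bb j * m * s) ^ (p + 1) / (1 - cd.bb j * m * s) * wW cd j c) ∧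
        (∀ (v : Fin (nW cd) → ℝ) (ρ : ℝ), 0 ≤ ρ → (∀ c, |v c| ≤ ρ * wW cd j c) → cd.bb j * (m + ρ) * t < 1 →
          (∀ (k : ℕ) c, |varJet (Qw cd) x v k c| ≤ ((k : ℝ) + 1) * ρ * (cd.bb j * m) ^ k * wW cd j c) ∧
          (∀ s ∈ Icc 0 t, ∀ c,
            |Φ (x + v) s c - Φ x s c| ≤ ((m + ρ) / (1 - cd.bb j * (m + ρ) * s) - m / (1 - cd.bb j * m * s)) * wW cd j c) ∧
          (∀ s ∈ Icc 0 t, ∀ (p : ℕ) c,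
            |Φ (x + v) s c - Φ x s c - ∑ k ∈ Finset.range (p + 1), varJet (Qw cd) x v k c * s ^ k| ≤
              ((m + ρ) / (1 - cd.bb j * (m + ρ) * s) - m / (1 - cd.bb j * m * s) - ρ / (1 - cd.bb j * m * s) ^ 2 +
                ρ * ((((p : ℝ) + 2) * (cd.bb j * m * s) ^ (p + 1) - ((p : ℝ) + 1) * (cd.bb j * m * s) ^ (p + 2)) /
                  (1 - cd.bb j * m * s) ^ 2)) * wW cd j c) ∧
          (∀ s ∈ Icc 0 t, ∃ L : (Fin (nW cd) → ℝ) →L[ℝ] (Fin (nW cd) → ℝ),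
            HasFDerivAt (fun y => Φ y s) L (x + v) ∧
            (∀ (z : Fin (nW cd) → ℝ) (ζ : ℝ), 0 ≤ ζ → (∀ c, |z c| ≤ ζ * wW cd j c) →
              ∀ c, |L z c| ≤ ζ / (1 - cd.bb j * (m + ρ) * s) ^ 2 * wW cd j c) ∧
            (∀ (z : Fin (nW cd) → ℝ) (ζ : ℝ) (p : ℕ), 0 ≤ ζ → (∀ c, |z c| ≤ ζ * wW cd j c) →
              ∀ c, |L z c - ∑ k ∈ Finset.range (p + 1), varJet (Qw cd) x z k c * s ^ k| ≤
                ζ * ((((p : ℝ) + 2) * (cd.bb j * m * s) ^ (p + 1) - ((p : ℝ) + 1) * (cd.bb j * m * s) ^ (p + 2)) /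
                    (1 - cd.bb j * m * s) ^ 2 +
                  (1 / (1 - cd.bb j * (m + ρ) * s) ^ 2 - 1 / (1 - cd.bb j * m * s) ^ 2)) * wW cd j c)))

/-- **S1 instantiated at stage `j`.** Positive weights, `0 ≤ bb j` and the certificate's weighted bilinear
bound (B) give a window flow with S1's conclusions. [folklore] -/
theorem exists_windowPack (hS : TaylorModelSoundness) {j : ℕ} (hω : ∀ k, 0 < cd.ω j k) (hbb : 0 ≤ cd.bb j)
    (hB : ∀ (u v : Fin 4 → ℤ → ℝ) (Nu Nv : ℝ), 0 ≤ Nu → 0 ≤ Nv →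
      cd.InBall j u Nu → cd.InBall j v Nv → cd.InBall j (cd.Qb u v) (cd.bb j * Nu * Nv)) :
    ∃ Φ : (Fin (nW cd) → ℝ) → ℝ → Fin (nW cd) → ℝ, WindowPack cd j Φ :=
  hS (nW cd) (Qw cd) (wW cd j) (cd.bb j) (taylorJet (Qw cd)) (varJet (Qw cd)) (wW_pos cd hω) hbb
    (isLinearMap_Qw_right cd) (isLinearMap_Qw_left cd) (Qw_weighted_bound cd hB) (taylorJet_zero (Qw cd))
    (taylorJet_succ_apply (Qw cd)) (varJet_zero (Qw cd)) (varJet_succ_apply (Qw cd))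

/-! ### The lifted cascade flow -/

/-- The cascade-coordinate flow of K1b-DR's shape built from a window flow: window components are the window
flow of the restricted datum, off-window components vanish. [folklore] -/
def liftFlow (Φ : (Fin (nW cd) → ℝ) → ℝ → Fin (nW cd) → ℝ) (z : Fin 4 → ℤ → ℝ) (i : Fin 4) (k : ℤ)
    (t : ℝ) : ℝ :=
  if h : -cd.Kb ≤ k ∧ k ≤ cd.Ka then Φ (toVec cd z) t (eW cd (i, ⟨k, Finset.mem_Icc.2 h⟩)) else 0

variable {cd}
variable {Φ : (Fin (nW cd) → ℝ) → ℝ → Fin (nW cd) → ℝ}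

/-- The state vector of the lifted flow is the zero extension of the window flow. [folklore] -/
theorem stAt_liftFlow (j : ℕ) (z : Fin 4 → ℤ → ℝ) (t : ℝ) :
    stAt (fun _ => liftFlow cd Φ) j z t = ofVec cd (Φ (toVec cd z) t) := by
  funext i k
  rfl

/-- A window component of the lifted flow is the corresponding coordinate of the window flow. [folklore] -/
theorem liftFlow_of_mem (z : Fin 4 → ℤ → ℝ) (i : Fin 4) {k : ℤ} (h : -cd.Kb ≤ k ∧ k ≤ cd.Ka) (t : ℝ) :
    liftFlow cd Φ z i k t = Φ (toVec cd z) t (eW cd (i, ⟨k, Finset.mem_Icc.2 h⟩)) := by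
  simp [liftFlow, h]

/-- **(F0)** Off-window components of the lifted flow vanish. [folklore] -/
theorem liftFlow_off_window (z : Fin 4 → ℤ → ℝ) (i : Fin 4) {k : ℤ} (h : ¬(-cd.Kb ≤ k ∧ k ≤ cd.Ka)) (t : ℝ) :
    liftFlow cd Φ z i k t = 0 := by
  simp [liftFlow, h]

/-- The lifted flow only sees the window coordinates of its datum. [folklore] -/
theorem liftFlow_trunc (z : Fin 4 → ℤ → ℝ) : liftFlow cd Φ (trunc cd z) = liftFlow cd Φ z := by
  funext i k t
  simp only [liftFlow, toVec_trunc]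

/-- The window-truncated `quadTerm` field of K1b-DR's ODE clause, on a family `X : Fin 4 → ℤ → ℝ → ℝ`, at a
window shell equals the certificate's truncated field of the time slice. [folklore] -/
theorem quadTerm_trunc_eq_qT (X : Fin 4 → ℤ → ℝ → ℝ) (i : Fin 4) {k : ℤ} (hk : -cd.Kb ≤ k ∧ k ≤ cd.Ka) (t : ℝ) :
    quadTerm 1 cd.α (fun j' n s' => if -cd.Kb ≤ n ∧ n ≤ cd.Ka then X j' n s' else 0) i k t =
      cd.qT (fun j' n => X j' n t) i k := by
  unfold CertData.qT
  rw [if_pos hk]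
  simp only [quadTerm]

/-- The truncated field of a state, read in window coordinates, is the transported field `Qw`. [folklore] -/
theorem toVec_qT (y : Fin 4 → ℤ → ℝ) : toVec cd (cd.qT y) = Qw cd (toVec cd y) (toVec cd y) := by
  rw [Qw, ofVec_toVec, Qb_trunc, Qb_self]

/-- A window component of `qT` as a coordinate of `Qw`. [folklore] -/
theorem qT_eq_Qw_apply (y : Fin 4 → ℤ → ℝ) (i : Fin 4) {k : ℤ} (hk : -cd.Kb ≤ k ∧ k ≤ cd.Ka) :
    cd.qT y i k = Qw cd (toVec cd y) (toVec cd y) (eW cd (i, ⟨k, Finset.mem_Icc.2 hk⟩)) := by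
  have h := congrFun (toVec_qT (cd := cd) y) (eW cd (i, ⟨k, Finset.mem_Icc.2 hk⟩))
  rw [← h]
  simp [toVec, modeOf, shellOf]

/-! ### (F1) existence under the majorant guard -/

section Pack

variable {j : ℕ} (hP : WindowPack cd j Φ)
include hP

/-- The lifted flow starts at (the window part of) its datum. [folklore] -/
theorem liftFlow_zero (z : Fin 4 → ℤ → ℝ) (i : Fin 4) {k : ℤ} (hk : -cd.Kb ≤ k ∧ k ≤ cd.Ka) :
    liftFlow cd Φ z i k 0 = z i k := by
  rw [liftFlow_of_mem z i hk, hP.1]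
  simp [toVec, modeOf, shellOf]

/-- **(F1a)** Under the guard `bb·m·T < 1` for a datum in `Ball_j(m)`, the lifted flow solves K1b-DR's ODE
clause on `[0, T]`. [folklore] -/
theorem solvesOn_liftFlow {z : Fin 4 → ℤ → ℝ} {m T : ℝ} (hm : 0 ≤ m) (hz : cd.InBall j z m) (hT : 0 ≤ T)
    (hg : cd.bb j * m * T < 1) : SolvesOn cd (fun _ => liftFlow cd Φ) j z T := by
  intro i k hk1 hk2
  have hk : -cd.Kb ≤ k ∧ k ≤ cd.Ka := ⟨hk1, hk2⟩
  refine ⟨liftFlow_zero hP z i hk, fun t' ht' => ?_⟩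
  have hzw : ∀ c, |toVec cd z c| ≤ m * wW cd j c := (inBall_iff_toVec cd j z m).1 hz
  have hsol := (hP.2.2 (toVec cd z) m T hm hzw hT hg).1 t' ht'
  -- the component `c = (i,k)` of the vector-valued derivative
  set c : Fin (nW cd) := eW cd (i, ⟨k, Finset.mem_Icc.2 hk⟩) with hc
  have hcomp : HasDerivWithinAt (fun s => Φ (toVec cd z) s c)
      (Qw cd (Φ (toVec cd z) t') (Φ (toVec cd z) t') c) (Icc 0 T) t' :=
    (hasDerivWithinAt_pi.1 hsol) c
  have hfun : (fun s => liftFlow cd Φ z i k s) = fun s => Φ (toVec cd z) s c := by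
    funext s; rw [liftFlow_of_mem z i hk]
  rw [show (fun _ => liftFlow cd Φ) j z i k = fun s => liftFlow cd Φ z i k s from rfl, hfun]
  convert hcomp using 1
  rw [quadTerm_trunc_eq_qT (cd := cd) _ i hk, qT_eq_Qw_apply (cd := cd) _ i hk]
  congr 1 <;>
  · funext c'
    simp only [toVec]
    rw [liftFlow_of_mem _ _ (shellOf_mem cd c')]
    congr 1
    exact (Equiv.apply_symm_apply (eW cd) c')

/-- **(F1b)** The majorant value bound `m/(1 − bb·m·t)` along `[0, T]`. [folklore] -/
theorem inBall_stAt_liftFlow {z : Fin 4 → ℤ → ℝ} {m T : ℝ} (hm : 0 ≤ m) (hz : cd.InBall j z m) (hT : 0 ≤ T)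
    (hg : cd.bb j * m * T < 1) {t : ℝ} (ht : t ∈ Icc 0 T) :
    cd.InBall j (stAt (fun _ => liftFlow cd Φ) j z t) (m / (1 - cd.bb j * m * t)) := by
  rw [stAt_liftFlow, inBall_ofVec_iff]
  exact (hP.2.2 (toVec cd z) m T hm ((inBall_iff_toVec cd j z m).1 hz) hT hg).2.2.1 t ht

/-! ### (F2) uniqueness -/

/-- **(F2)** Every solution of K1b-DR's ODE clause on `[0, T]` from `z` (window components) coincides there
with the lifted flow. [folklore] -/
theorem liftFlow_unique {z : Fin 4 → ℤ → ℝ} {T : ℝ} {ψ : Fin 4 → ℤ → ℝ → ℝ} (hT : 0 ≤ T)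
    (hψ : ∀ i k, -cd.Kb ≤ k → k ≤ cd.Ka → ψ i k 0 = z i k ∧ ∀ t' ∈ Icc 0 T,
      HasDerivWithinAt (ψ i k)
        (quadTerm 1 cd.α (fun j' n s' => if -cd.Kb ≤ n ∧ n ≤ cd.Ka then ψ j' n s' else 0) i k t')
        (Icc 0 T) t') :
    ∀ i k, -cd.Kb ≤ k → k ≤ cd.Ka → ∀ t' ∈ Icc 0 T, ψ i k t' = liftFlow cd Φ z i k t' := by
  -- the solution read in window coordinates
  set ψw : ℝ → Fin (nW cd) → ℝ := fun s => toVec cd (fun i k => ψ i k s) with hψw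
  have h0 : ψw 0 = toVec cd z := by
    funext c
    simp only [hψw, toVec]
    exact (hψ _ _ (shellOf_mem cd c).1 (shellOf_mem cd c).2).1
  have hder : ∀ s ∈ Icc 0 T, HasDerivWithinAt ψw (Qw cd (ψw s) (ψw s)) (Icc 0 T) s := by
    intro s hs
    refine hasDerivWithinAt_pi.2 fun c => ?_
    have hk := shellOf_mem cd c
    have h1 := (hψ (modeOf cd c) (shellOf cd c) hk.1 hk.2).2 s hs
    rw [quadTerm_trunc_eq_qT (cd := cd) _ _ hk, qT_eq_Qw_apply (cd := cd) _ _ hk] at h1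
    have hc : eW cd (modeOf cd c, ⟨shellOf cd c, Finset.mem_Icc.2 hk⟩) = c := Equiv.apply_symm_apply (eW cd) c
    rw [hc] at h1
    exact h1
  have huniq := hP.2.1 (toVec cd z) T ψw hT h0 hder
  intro i k hk1 hk2 t' ht'
  have hk : -cd.Kb ≤ k ∧ k ≤ cd.Ka := ⟨hk1, hk2⟩
  have h := congrFun (huniq t' ht') (eW cd (i, ⟨k, Finset.mem_Icc.2 hk⟩))
  rw [liftFlow_of_mem z i hk, ← h]
  simp [hψw, toVec, modeOf, shellOf]

/-! ### (F3) Lipschitz deviation -/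

/-- **(F3)** The majorant Lipschitz deviation between the flows from `x` and `x + v`. [folklore] -/
theorem inBall_stAt_liftFlow_sub (hbb : 0 ≤ cd.bb j) {x v : Fin 4 → ℤ → ℝ} {m ρ T : ℝ} (hm : 0 ≤ m)
    (hρ : 0 ≤ ρ) (hx : cd.InBall j x m) (hv : cd.InBall j v ρ) (hT : 0 ≤ T)
    (hg : cd.bb j * (m + ρ) * T < 1) {t : ℝ} (ht : t ∈ Icc 0 T) :
    cd.InBall j (stAt (fun _ => liftFlow cd Φ) j (x + v) t - stAt (fun _ => liftFlow cd Φ) j x t)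
      ((m + ρ) / (1 - cd.bb j * (m + ρ) * t) - m / (1 - cd.bb j * m * t)) := by
  have hmT : cd.bb j * m * T < 1 := by
    have h1 : cd.bb j * m * T ≤ cd.bb j * (m + ρ) * T := by
      have hb : 0 ≤ cd.bb j * T := mul_nonneg hbb hT
      nlinarith
    exact lt_of_le_of_lt h1 hg
  have key := (hP.2.2 (toVec cd x) m T hm ((inBall_iff_toVec cd j x m).1 hx) hT hmT).2.2.2.2
    (toVec cd v) ρ hρ ((inBall_iff_toVec cd j v ρ).1 hv) hg
  rw [stAt_liftFlow, stAt_liftFlow, ← ofVec_sub, inBall_ofVec_iff]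
  intro c
  have h := key.2.1 t ht c
  simpa [toVec_add] using h

end Pack

end Summit.NavierStokesRegularity.NavierStokesRegularity.Theorems.TaylorModelReadout

end
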